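import Literature.IUT.LogVolume.Corollary22FullGaloisImage
import Literature.IUT.LogVolume.Corollary22FreyPoint
import Literature.IUT.LogVolume.Corollary22DegInfBound
import Literature.NumberTheory.DiophantineGeometry.GenEllLCyclicHeightBoundLinear
import Literature.NumberTheory.Sieve.SelbergSymmetryFormula
import HarnessLib

/-!
# Route `IUTThetaPilot`, crux `ThetaPartII` (stmt-ABC-19678): the «d = 1 cut» WITHOUT `K_V` — preliminaries
# (the `K_V`-free Galois-image input at the rational points, and the real arithmetic of pp. 46–48)

Mochizuki, *Inter-universal Teichmüller theory IV*, RIMS manuscript (Apr. 2020; = PRIMS **57** (2021)), Cor. 2.2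
(ii), proof pp. 43–48 [cite: Mochizuki2012, IUTchIV Cor. 2.2 (ii) pp. 41–48]. PROOF-ONLY helper on the crux item
(does not close it); companion of `IUTThetaPilotABCExpThreeDegOne.lean` (abc-iut-S6), which runs the proof of
Cor. 2.2 (ii) at the Frey–Legendre point `λ = a/c` of an ARBITRARY abc triple without any compactly bounded
subset. Here: (1) `condP6_ratPoint_triple` — the classical input (P4) ⟹ (P6) of pp. 45–46 at the rational
points, with the archimedean bound EXPLICIT (`Cor22.htInfty_ratPoint_triple_le`: `ht_∞ ≤ 6 log c + log 256`,
whence `ht_∞ ≤ 3·deg_∞ + 10` by `Cor22.two_mul_log_oddPart_le_logQNotTwo`, `Cor22.natCast_le_two_mul_oddPart`,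
`Cor22.logQForall_le_degInf_thetaEllPoint`) in place of the `K_V`-bound on the conjugates of `j`
(`GenEll.exists_degInf_le_of_admitsLCyclic_of_htInf_le_three`); (2) two real-variable lemmas: the `K_V`-free
(P5)-exclusion `sq_le_of_le_add_mul_log` and the assembled arithmetic of pp. 46–48 at `d_mod = 1`, `arith_core`.
Classical / pure arithmetic; nothing about Theorem 1.10 is used or asserted; no side taken on [IUTchIII] Cor. 3.12.
-/

set_option linter.dupNamespace false

noncomputable section

namespace Summit.ABC.ABC.Theorems.ThetaPartIIDegOne

open Literature.IUT.LogVolume Literature.IUT.LogVolume.Cor22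
open Literature.NumberTheory.DiophantineGeometry Literature.NumberTheory.DiophantineGeometry.GenEll
open NumberField IsDedekindDomain Real

/-! ## (P4) ⟹ (P6) at the Frey–Legendre points, without `K_V` -/

/-- **(P4) ⟹ (P6) for the rational points `a/c` of abc triples** ([IUTchIV] Cor. 2.2 (ii) pp. 45–46 with the
archimedean input EXPLICIT): there is an absolute `G` such that for every abc triple, every prime `l ≥ 7` with
(P2), (P5) and `G < log(q^∀(a/c))`, condition (P6) holds for every theta field. The tree's
`Cor22.condP6_of_seven_le` verbatim, with `exists_degInf_le_of_admitsLCyclic_of_htInf_le_three`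
(`ht_∞ ≤ 3·deg_∞ + 10`) in place of the `K_V`-bound on the `j`-conjugates.
[cite: Mochizuki2012, IUTchIV Cor. 2.2 proof (P4)–(P6) pp. 45–46] -/
theorem condP6_ratPoint_triple :
    ∃ G : ℝ, ∀ a b c : ℕ, IsABCTriple a b c → ∀ l : ℕ, l.Prime → 7 ≤ l →
      CondP2 (ratPoint ((a : ℚ) / c)) l → CondP5 (ratPoint ((a : ℚ) / c)) l →
      G < logQForall (ratPoint ((a : ℚ) / c)) → CondP6 (ratPoint ((a : ℚ) / c)) l := by
  obtain ⟨B, hB⟩ := exists_degInf_le_of_admitsLCyclic_of_htInf_le_three (6 * Real.log 2 + Real.log 256)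
  refine ⟨B, fun a b c ht l hl h7 hP2 hP5 hh => ?_⟩
  set P := ratPoint ((a : ℚ) / c) with hP
  intro hU F _ _ _ hF _
  haveI : Fact l.Prime := ⟨hl⟩
  letI iA : Algebra P.F (thetaEllPoint P hU F).F := ‹Algebra P.F F›
  haveI iG : IsGalois P.F (thetaEllPoint P hU F).F := hF.isGalois
  have hdeg : Module.finrank P.F (thetaEllPoint P hU F).F ∣ 46080 := hF.finrank_dvd
  have hj : (thetaEllPoint P hU F).W.j = algebraMap P.F (thetaEllPoint P hU F).F (jInv P.x) :=
    thetaCurve_j F hU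
  have hss : (thetaEllPoint P hU F).IsSemistable := hF.isSemistable
  refine imageModLContainsSL2_of_condP5 (thetaEllPoint P hU F) hj hdeg hss h7 hP2 hP5 ?_
  intro hcyc
  -- the explicit archimedean input: `ht_∞ ≤ 6 log c + log 256 ≤ 3·log(q^{∤2}) + 6 log 2 + log 256`
  have h2 : 2 * Real.log (ordCompl[2] (a * b * c) : ℕ) ≤ logQNotTwo P := two_mul_log_oddPart_le_logQNotTwo ht
  have hc2 : (c : ℝ) ≤ 2 * (ordCompl[2] (a * b * c) : ℕ) := natCast_le_two_mul_oddPart ht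
  have hc0 : (0 : ℝ) < c := by have := ht.2.2.1; have := ht.1; exact_mod_cast (by omega : 0 < c)
  have hodd0 : (0 : ℝ) < (ordCompl[2] (a * b * c) : ℕ) := by linarith
  have hlogc : Real.log c ≤ Real.log 2 + Real.log (ordCompl[2] (a * b * c) : ℕ) := by
    rw [← Real.log_mul (by norm_num) hodd0.ne']
    exact Real.log_le_log hc0 hc2
  have hq : logQNotTwo P ≤ logQForall P := logQAvoid_anti P (Finset.empty_subset _)
  have hdi : logQForall P ≤ (thetaEllPoint P hU F).degInf := logQForall_le_degInf_thetaEllPoint F hU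
  have hHA : (thetaEllPoint P hU F).htInf ≤ 3 * (thetaEllPoint P hU F).degInf + (6 * Real.log 2 + Real.log 256) := by
    rw [htInf_eq_htInfty (thetaEllPoint P hU F) hj]
    have := htInfty_ratPoint_triple_le ht
    linarith
  have h5 : 5 ≤ l := le_trans (by norm_num) h7
  have := hB (thetaEllPoint P hU F) l hl h5 hss hHA
    (not_dvd_localHeight_of_condP2 (thetaEllPoint P hU F) hj hdeg hl h7 hP2) hcyc
  linarith

/-! ## Two elementary real-variable lemmas (`log x ≤ 2√x` is the tree's `SelbergSymmetry.log_le_two_mul_sqrt`) -/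

/-- The (P5)-exclusion in `K_V`-free form: from `s ≥ 5`, `5 ≤ l ≤ 20δ²s⁴` and `s² ≤ A + 3·s·log l` (`A ≥ 0`,
`δ ≥ 2`) one gets `s² ≤ (A + 81 + 6δ)⁴` (`log l ≤ 19 + 2δ + 8√s`, then divide `r⁴ ≤ (A+81+6δ)r³`, `r = √s`).
[folklore] -/
theorem sq_le_of_le_add_mul_log {s δ l A : ℝ} (hs : 5 ≤ s) (hδ : 2 ≤ δ) (hA : 0 ≤ A) (hl5 : 5 ≤ l)
    (hl : l ≤ 20 * δ ^ 2 * s ^ 4) (hmain : s ^ 2 ≤ A + 3 * s * Real.log l) :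
    s ^ 2 ≤ (A + 81 + 6 * δ) ^ 4 := by
  have hs0 : 0 < s := by linarith
  have hδ0 : 0 < δ := by linarith
  have hl0 : 0 < l := by linarith
  set r := Real.sqrt s with hr
  have hr0 : 0 < r := Real.sqrt_pos.mpr hs0
  have hr2 : r ^ 2 = s := Real.sq_sqrt hs0.le
  have hr1 : 1 ≤ r := by
    rw [hr, ← Real.sqrt_one]; exact Real.sqrt_le_sqrt (by linarith)
  -- `log l ≤ 19 + 2δ + 8 r`
  have hlogl : Real.log l ≤ 19 + 2 * δ + 8 * r := by
    have h1 : Real.log l ≤ Real.log (20 * δ ^ 2 * s ^ 4) := Real.log_le_log hl0 hl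
    have h2 : Real.log (20 * δ ^ 2 * s ^ 4) = Real.log 20 + 2 * Real.log δ + 4 * Real.log s := by
      rw [Real.log_mul (by positivity) (by positivity), Real.log_mul (by norm_num) (by positivity),
        Real.log_pow, Real.log_pow]
      push_cast; ring
    have h20 : Real.log 20 ≤ 19 := by
      have := Real.log_le_sub_one_of_pos (show (0 : ℝ) < 20 by norm_num); linarith
    have hlδ : Real.log δ ≤ δ := (Real.log_le_sub_one_of_pos hδ0).trans (by linarith)
    have hls : Real.log s ≤ 2 * r := Literature.NumberTheory.Sieve.SelbergSymmetry.log_le_two_mul_sqrt hs0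
    linarith
  -- `r⁴ ≤ (A + 81 + 6δ)·r³`
  set M : ℝ := A + 81 + 6 * δ with hM
  have hM0 : 0 ≤ M := by rw [hM]; positivity
  have hr3 : 1 ≤ r ^ 3 := one_le_pow₀ hr1
  have hr23 : r ^ 2 ≤ r ^ 3 := by nlinarith
  have h4 : r ^ 4 ≤ M * r ^ 3 := by
    have e1 : s ^ 2 = r ^ 4 := by rw [← hr2]; ring
    have e2 : s * Real.log l ≤ s * (19 + 2 * δ + 8 * r) := mul_le_mul_of_nonneg_left hlogl hs0.le
    have : r ^ 4 ≤ A + (57 + 6 * δ) * r ^ 2 + 24 * r ^ 3 := by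
      rw [← e1]
      have : A + 3 * s * Real.log l ≤ A + (57 + 6 * δ) * s + 24 * (s * r) := by nlinarith
      calc s ^ 2 ≤ A + 3 * s * Real.log l := hmain
        _ ≤ A + (57 + 6 * δ) * s + 24 * (s * r) := this
        _ = A + (57 + 6 * δ) * r ^ 2 + 24 * r ^ 3 := by rw [← hr2]; ring
    calc r ^ 4 ≤ A + (57 + 6 * δ) * r ^ 2 + 24 * r ^ 3 := this
      _ ≤ A * r ^ 3 + (57 + 6 * δ) * r ^ 3 + 24 * r ^ 3 := by nlinarith
      _ = M * r ^ 3 := by rw [hM]; ring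
  have hrM : r ≤ M := by
    have : r * r ^ 3 ≤ M * r ^ 3 := by nlinarith
    exact le_of_mul_le_mul_right this (by positivity)
  calc s ^ 2 = r ^ 4 := by rw [← hr2]; ring
    _ ≤ M ^ 4 := by gcongr

/-- The real arithmetic of pp. 46–48 at a degree-one point, `K_V`-free: from the display (`d_mod = 1`,
`log-diff = 0`), (P1), (P3), the Frey bounds and the `ε_E`-threshold, `X = log (abc)_{odd}` satisfies
`X ≤ 3(1+ε)·R + (5ε/6 + 120η)` (`R = log rad(abc)`). [cite: Mochizuki2012, IUTchIV Cor. 2.2 proof pp. 46–48] -/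
theorem arith_core {X h s R q q₂ Lc lR logl W η ε : ℝ} (hε : 0 < ε) (hε1 : ε ≤ 1) (hR0 : 0 ≤ R)
    (hη0 : 0 ≤ η) (hLc : Lc ≤ R) (hl0 : 0 < lR)
    (hX2 : 2 * X ≤ q₂) (hQ1 : q₂ - q ≤ s * logl)
    (hd2 : 1 / 6 * q ≤ (1 + 20 / lR) * Lc + 20 * (552960 * lR + η))
    (h20 : 20 / lR ≤ ε / 4) (hlW : lR ≤ 10 * 552960 * W) (hT2 : s * logl ≤ 3 * W)
    (hWle : 3600 * 552960 ^ 2 * W ≤ ε / 6 * h) (hh6 : h ≤ 6 * X + 10) :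
    X ≤ 3 * (1 + ε) * R + (5 * (ε / 6) + 120 * η) := by
  have h20' : 0 ≤ 20 / lR := by positivity
  have hcoef : (1 + 20 / lR) * Lc ≤ (1 + ε / 4) * R :=
    calc (1 + 20 / lR) * Lc ≤ (1 + 20 / lR) * R := mul_le_mul_of_nonneg_left hLc (by linarith)
      _ ≤ (1 + ε / 4) * R := mul_le_mul_of_nonneg_right (by linarith) hR0
  -- `2X ≤ 6(1+ε/4)R + 120·(552960 l + η) + s log l`
  have hchain : 2 * X ≤ 6 * (1 + ε / 4) * R + 120 * (552960 * lR + η) + s * logl := by linarith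
  -- error terms
  have h1 : 120 * (552960 * lR) ≤ 1200 * 552960 ^ 2 * W := by linarith
  have herr : 120 * (552960 * lR) + s * logl ≤ ε / 6 * h / 2 := by nlinarith
  have habs : ε / 6 * h / 2 ≤ (ε / 2) * X + 5 * (ε / 6) := by
    have hm := mul_le_mul_of_nonneg_left hh6 (by positivity : (0 : ℝ) ≤ ε / 6)
    linarith
  have hXineq : X * (2 - ε / 2) ≤ 6 * (1 + ε / 4) * R + (5 * (ε / 6) + 120 * η) := by nlinarith
  have hK0 : 0 ≤ 5 * (ε / 6) + 120 * η := by positivity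
  have h1' : 0 ≤ ε * (2 - ε) * R := mul_nonneg (mul_nonneg hε.le (by linarith)) hR0
  have h2' : 0 ≤ (5 * (ε / 6) + 120 * η) * (1 - ε / 2) := mul_nonneg hK0 (by linarith)
  have hfin : X * (2 - ε / 2) ≤ (3 * (1 + ε) * R + (5 * (ε / 6) + 120 * η)) * (2 - ε / 2) := by
    nlinarith
  exact le_of_mul_le_mul_right hfin (by linarith)

end Summit.ABC.ABC.Theorems.ThetaPartIIDegOne

end
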